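import Summits.AtomisticToContinuum.Crystallization.Theses.SpectralChargeLedger
import Summits.AtomisticToContinuum.Crystallization.Theses.PhononSlackCertificates
import Summits.AtomisticToContinuum.Crystallization.Theorems.ChargedEnergyGap.Negative.BlocksBound
import Summits.AtomisticToContinuum.Crystallization.Theorems.SpectralChargeLedgerSummedShellPricingEquivalences
import Summits.AtomisticToContinuum.Crystallization.Theorems.HullExactificationCascadeHcpLandscapeGapStubBoxMinimiserRigid
import Summits.AtomisticToContinuum.Crystallization.Theorems.SpectralChargeLedgerSummedShellPricingSpoiledByGross
import Summits.AtomisticToContinuum.Crystallization.Theorems.SpectralChargeLedgerSummedShellPricingTorusDivergence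
import Summits.AtomisticToContinuum.Crystallization.Theorems.SpectralChargeLedgerSummedShellPricingCalibratedFloor

/-!
# Crux `SpectralChargeLedger.SummedShellPricing` (K1, stmt-AtomisticToContinuum-17044) — line `Sketch`,
# skeleton v4 (lead c2, 2026-08-17): the e⋆-free, cell-pinned, CALIBRATED reshape of the core —
# periodic hosts, quadratic price law, geometric bridges cut out

**v4 in one paragraph (lead c2).**  The v3 residual `stub_calibratedSiteInequality` (∀ S ⊆ ℝ³) is replaced by
`stub_calibratedSiteInequalityQuadratic`: PERIODIC hosts only (all the composition ever used), covariance under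
the period lattice only, explicit price law `κ = c·τ²` for `τ ≤ 1/20` (the `∀ τ ∃ κ` form for `τ ≤ 1` is the
sorry-free `calibratedSiteInequalityPeriodic`, by monotonicity of τ-goodness), and the two geometric bridges
"two-way matched `3a/2`-neighbourhood ⇒ τ-good shell" (`stub_goodShell_of_matching_hcp/fcc`, M, workers) cut
out and fed to the residual as hypotheses.  Registered stubs (4): `stub_coerciveTwoShellGap` (hub 13956),
`stub_calibratedSiteInequalityQuadratic` (XL, lead), `stub_goodShell_of_matching_hcp`, `stub_goodShell_of_matching_fcc`.
The history below is kept from v3.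

**History.**  Cycle 1 (lead c0) reduced K1 to its torus form and landed the glue
`hub crux 13956 ∧ torusCoercivity ⇒ K1` (`SummedShellPricingEquivalences`, p167766), leaving two crux-sized
stubs: the hub crux `CoerciveTwoShellGap` (stmt-13956) and the core `stub_torusCoercivity` (K1 modulo 13956,
reference energy `e⋆ = ⨅_Q e(Q)`, irrefutable in Lean).  The strategists (s0/s1) re-typed the core RELATIVE TO
THE EXPLICIT hcp CRYSTAL (`HcpRelativeLedger`; glue `torusCoercivity_of_hcpRelativeLedger`, also landed as
p169653) and cut it into an INTERIOR ledger plus a packing lemma (`Lines/hcp_relative_ledger.lean`).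

**This reshape (v2)** adopts that cut and PINS THE CELL: the interior ledger is asked at every box minimiser
`(a, h)` of `e(hcp ·,·)` on the open box `9/10 < a < 1`, `|h − a√(2/3)| ≤ a/100` — the hypothesis texts of the
sibling crux `HullExactificationCascade.HcpLandscapeGap` (stmt-12087) — whose existence
(`HcpLandscapeGapBirth.stub_boxMinimiser`) and certified enclosure `(0.97129, 0.79294) ± 10⁻⁴`
(`stub_boxMinimiserRigid`) are LANDED; the enclosure puts the cell in K1's box `47/50 ≤ a ≤ 1`.  So the residual
`stub_interiorLedgerAt` has NO existential cell left: it is a statement about explicit lattice sums at a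
certified cell, refutable by any explicit periodic competitor, and literally comparable with stmt-12087
(same cell, same reference energy; 12087 prices EVERYWHERE-good templated sets, this stub prices the deep-good
part of ARBITRARY periodic hosts with an allowance for the rest).

**v3 (same session)** cuts `stub_interiorLedgerAt` along the CALIBRATION mechanism (discrete null
Lagrangian): a pointwise calibrated site inequality at deep-good sites (`stub_calibratedSiteInequality`,
XL, the analytic core), the exact vanishing of the divergence of a lattice-covariant antisymmetric pair
flux over the motif (`stub_torusDivergence`, M–L) and a flat calibrated floor on separated sets
(`stub_calibratedFloor`, S–M); composition `interiorLedgerAt_of_calibration` (sorry-free).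

Composition (sorry-free): calibrated site inequality ∧ torus divergence ∧ floor ⇒ `interiorLedgerAt` at
every box minimiser ⇒ at the landed box minimiser the ∃-cell interior ledger (`interiorLedger_exists`) ⇒
with `stub_spoiledByGross`: `HcpRelativeLedger` (`hcpRelativeLedger_of`) ⇒ the e⋆-core
(`torusCoercivity_of_hcpRelativeLedger`, `e⋆ ≤ e(hcp)`) ⇒ K1 by name from `stub_coerciveTwoShellGap`
(`SummedShellPricing_of`).  Registered stubs (5): `stub_coerciveTwoShellGap` (hub 13956),
`stub_calibratedSiteInequality` (XL, the residual); LANDED (this session, all ACCEPTED) and used by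
tree name: `stub_spoiledByGross` (M) p172384, `stub_torusDivergence` (M–L) p172565, `stub_calibratedFloor`
(S–M) p172604.  Open: the hub item `stub_coerciveTwoShellGap` (stmt-13956) and the residual CSI.

Disproof used (Cruxes/SummedShellPricing/Disproof.lean, cdisprove cycle 1, and the landed
`Theorems/SummedShellPricing/Negative/{PricingClause,Strengthenings,Cells}`): the cell is no longer planted
or existential but FORCED to argmin e(hcp) (`not_summedShellPricing_forall_cells`: any other cell is refuted
by the hcp(argmin) competitor); `c = c(τ)` after `τ` (`not_uniformKappa`, `not_linearKappa`,
tightness `kappa_le_of_pricingClause` ⇒ any proof gives `c(τ) = O(τ²)`); `τ > 0`; separation in every stub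
(`summedShellPricing_false_without_separation`); only BAD sites priced (`…_false_without_bad`).  No sitewise
fixed multiplier (negative edge `OneMultiplierPricing`, stmt-17253): all pricing statements are SUMMED.
-/

namespace Summit.AtomisticToContinuum.Crystallization.Cruxes.SummedShellPricing.Sketch

open scoped BigOperators Classical
open Literature.MathematicalPhysics.StatisticalMechanics Literature.Geometry.DiscreteGeometry
open Summit.AtomisticToContinuum.Crystallization.Theorems
open Summit.AtomisticToContinuum.Crystallization.Theorems.ChargedEnergyGapNegative (eStar_le)

/-- **τ-good first shell at the cell `(a₀, h₀)`** — verbatim the disjunction of K1 / of the core stub of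
line `Sketch`: the open punctured `13/10·a₀`-shell of `q` in `S` is matched, after a linear isometry and a
bijection, within `τ` to the 12-shell of `hcpStacking a₀ h₀` or of `fccStacking a₀ h₀`. [folklore] -/
def GoodShell (a₀ h₀ τ : ℝ) (S : Set (EuclideanSpace ℝ (Fin 3))) (q : EuclideanSpace ℝ (Fin 3)) : Prop :=
  ∃ A : EuclideanSpace ℝ (Fin 3) →ₗᵢ[ℝ] EuclideanSpace ℝ (Fin 3),
    (∃ e : ↥{z : EuclideanSpace ℝ (Fin 3) | z ∈ S ∧ z ≠ q ∧ dist z (q) < 13 / 10 * a₀} ≃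
        ↥{p : EuclideanSpace ℝ (Fin 3) | p ∈ hcpStacking a₀ h₀ ∧ p ≠ 0 ∧ ‖p‖ < 13 / 10 * a₀},
      ∀ t : ↥{z : EuclideanSpace ℝ (Fin 3) | z ∈ S ∧ z ≠ q ∧ dist z (q) < 13 / 10 * a₀},
        dist ((t : EuclideanSpace ℝ (Fin 3)) - q)
          (A ((e t : ↥{p : EuclideanSpace ℝ (Fin 3) | p ∈ hcpStacking a₀ h₀ ∧ p ≠ 0 ∧ ‖p‖ < 13 / 10 * a₀}) : EuclideanSpace ℝ (Fin 3))) ≤ τ) ∨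
    (∃ e : ↥{z : EuclideanSpace ℝ (Fin 3) | z ∈ S ∧ z ≠ q ∧ dist z (q) < 13 / 10 * a₀} ≃
        ↥{p : EuclideanSpace ℝ (Fin 3) | p ∈ fccStacking a₀ h₀ ∧ p ≠ 0 ∧ ‖p‖ < 13 / 10 * a₀},
      ∀ t : ↥{z : EuclideanSpace ℝ (Fin 3) | z ∈ S ∧ z ≠ q ∧ dist z (q) < 13 / 10 * a₀},
        dist ((t : EuclideanSpace ℝ (Fin 3)) - q)
          (A ((e t : ↥{p : EuclideanSpace ℝ (Fin 3) | p ∈ fccStacking a₀ h₀ ∧ p ≠ 0 ∧ ‖p‖ < 13 / 10 * a₀}) : EuclideanSpace ℝ (Fin 3))) ≤ τ)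

set_option linter.dupNamespace false in
/-- **The line's thesis `HcpRelativeLedger` (the e⋆-free core).**  One cell `(a₀,h₀)` in K1's box (with
`a₀, h₀ ≠ 0`, so that the relaxed hcp crystal `hcpPeriodicConfiguration` is available), an allowance
`C ≥ 0`, and for every `τ ∈ (0,1]` a price `c > 0` such that for every periodic `P` with `1/3`-separated
points: `c·#{mild} − C·#{gross} ≤ #motif·(e(P) − e(hcp(a₀,h₀)))`, mild = τ-bad at `(a₀,h₀)` but
`1/20`-two-shell-good, gross = not `1/20`-two-shell-good.  It is the core stub of line `Sketch` with the
periodic infimum `e⋆` replaced by the EXPLICIT reference `e(hcp(a₀,h₀)) ≥ e⋆`. [folklore] -/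
def HcpRelativeLedger : Prop :=
  ∃ (a₀ h₀ : ℝ) (ha : a₀ ≠ 0) (hh : h₀ ≠ 0), 47 / 50 ≤ a₀ ∧ a₀ ≤ 1 ∧ |h₀ - a₀ * Real.sqrt (2 / 3)| ≤ a₀ / 100 ∧
    ∃ C : ℝ, 0 ≤ C ∧ ∀ τ : ℝ, 0 < τ → τ ≤ 1 → ∃ c : ℝ, 0 < c ∧
      ∀ P : PeriodicConfiguration 3, (∀ u ∈ P.points, ∀ v ∈ P.points, u ≠ v → (1 / 3 : ℝ) ≤ dist u v) →
        c * ((P.motif.filter fun q => ¬ GoodShell a₀ h₀ τ P.points q ∧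
              IsTwoShellGoodSet (1 / 20) (47 / 50) 1 P.points q).card : ℝ)
          - C * ((P.motif.filter fun q => ¬ IsTwoShellGoodSet (1 / 20) (47 / 50) 1 P.points q).card : ℝ)
        ≤ (P.motif.card : ℝ) *
            (P.energyPerParticle lennardJones - (hcpPeriodicConfiguration ha hh).energyPerParticle lennardJones)

/-! ## The stubs -/

/-- **Stub 0 — the hub crux** `PhononSlackCertificates.CoerciveTwoShellGap` (stmt-AtomisticToContinuum-13956;
shared with line `Sketch`, staffed by its own line, equivalent to the torus two-shell gap at tolerance
`1/20`, p101526).  An existing statement item, not re-typed. [folklore] -/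
theorem stub_coerciveTwoShellGap :
    Summit.AtomisticToContinuum.Crystallization.Theses.PhononSlackCertificates.CoerciveTwoShellGap := by
  sorry

/-! ### The calibration cut of the interior ledger (skeleton v3 → v4)

The interior ledger at the box minimiser is obtained from a POINTWISE calibrated site inequality
(the analytic core), the exact vanishing of the divergence of a lattice-covariant antisymmetric pair
flux over the motif of a periodic configuration (`stub_torusDivergence`, LANDED p172565), and a flat
lower bound for calibrated site energies on `1/3`-separated sets (`stub_calibratedFloor`, LANDED
p172604).  Mechanism (discrete null Lagrangian / atomistic stress; Friesecke–Theil 2002,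
Conti–Dolzmann–Kirchheim–Müller 2006 Thm 4.2, Ortner–Theil 2013 §5; sibling line
`Cruxes/HcpLandscapeGap/Lines/calibration.md`).

**v4 (lead c2, 2026-08-17).**  (i) The calibrated site inequality is only ever applied to the point set of
a PERIODIC host (the torus form of K1), so the residual is now stated for `P : PeriodicConfiguration 3`
with covariance under `P.lattice` only (strictly weaker than v3's `∀ S ⊆ ℝ³`; no amenability /
infinite LP is hidden in it any more).  (ii) The price law is made explicit and the large-tolerance
regime split off: the residual `stub_calibratedSiteInequalityQuadratic` claims `κ(τ) = c·τ²` for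
`τ ≤ 1/20` only (the Disproof's tightness `κ ≤ 324(−e⋆)(τ/a₀)²`, `not_linearKappa`, says any true price
IS at most quadratic; every Taylor-type proof yields exactly a quadratic law), and the `∀ τ ∈ (0,1] ∃ κ`
form follows by monotonicity of τ-goodness (`goodShell_mono`, `calibratedSiteInequalityPeriodic`,
sorry-free).  (iii) The geometric bridge "two-way `θ`-matching of the `3a/2`-neighbourhood with the
rotated reference stacking ⇒ τ-good first shell" — the last step of any proof of the `κ`-clause — is cut
out as two worker stubs (`stub_goodShell_of_matching_hcp/fcc`, M, pattern
`SummedShellPricingChartShell.exists_shellEquiv_of_chart` p168192) and fed to the residual as hypotheses. -/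

/-- τ-goodness of a first shell is monotone in the tolerance (same isometry, same bijection). [folklore] -/
theorem goodShell_mono {a h τ τ' : ℝ} {S : Set (EuclideanSpace ℝ (Fin 3))} {y : EuclideanSpace ℝ (Fin 3)}
    (hτ : τ ≤ τ') (hg : GoodShell a h τ S y) : GoodShell a h τ' S y := by
  obtain ⟨A, ⟨e, he⟩ | ⟨e, he⟩⟩ := hg
  · exact ⟨A, Or.inl ⟨e, fun t => (he t).trans hτ⟩⟩
  · exact ⟨A, Or.inr ⟨e, fun t => (he t).trans hτ⟩⟩

/-- **Stub B-hcp — MATCHED NEIGHBOURHOOD ⇒ τ-GOOD SHELL, hcp reference (M; geometry, worker).**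
For a cell `(a, h)` in K1's box, tolerances `0 ≤ θ ≤ τ`, `θ ≤ a/20`, a `1/3`-separated `S ∋ y` and a linear
isometry `A`: if every non-zero point `p` of `hcpStacking a h` of norm `≤ 3a/2` has a point of `S` within
`θ` of `y + A p`, and every point of `S ∖ {y}` within `3a/2` of `y` is within `θ` of some `y + A p`,
`p ∈ hcpStacking a h`, then the first shell of `y` is τ-good at `(a, h)` (K1's disjunction, hcp disjunct,
with the same `A`).  Why true: the two-way matching restricted to the open `13a/10`-ball is a bijection
onto the twelve reference points of norm `< 13a/10` (reference norms are `≤ 1.009a` or `≥ 1.408a` on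
the box, `13a/10 + θ < 1.408a`; injective by `2θ < 1/3 ≤` separation of `S` and `2θ <` separation of the
stacking), cf. `SummedShellPricingChartShell.exists_shellEquiv_of_chart` /
`exists_equiv_of_two_way_matching` (p168192). [folklore] -/
theorem stub_goodShell_of_matching_hcp :
    ∀ (a h : ℝ), 47 / 50 ≤ a → a ≤ 1 → |h - a * Real.sqrt (2 / 3)| ≤ a / 100 →
    ∀ (θ τ : ℝ), 0 ≤ θ → θ ≤ τ → θ ≤ a / 20 →
    ∀ (S : Set (EuclideanSpace ℝ (Fin 3))), (∀ u ∈ S, ∀ v ∈ S, u ≠ v → (1 / 3 : ℝ) ≤ dist u v) →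
    ∀ y ∈ S, ∀ (A : EuclideanSpace ℝ (Fin 3) →ₗᵢ[ℝ] EuclideanSpace ℝ (Fin 3)),
      (∀ p ∈ hcpStacking a h, p ≠ 0 → ‖p‖ ≤ 3 / 2 * a → ∃ z ∈ S, dist z (y + A p) ≤ θ) →
      (∀ z ∈ S, z ≠ y → dist z y ≤ 3 / 2 * a → ∃ p ∈ hcpStacking a h, dist z (y + A p) ≤ θ) →
      (∃ A : EuclideanSpace ℝ (Fin 3) →ₗᵢ[ℝ] EuclideanSpace ℝ (Fin 3),
        (∃ e : ↥{z : EuclideanSpace ℝ (Fin 3) | z ∈ S ∧ z ≠ y ∧ dist z (y) < 13 / 10 * a} ≃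
            ↥{p : EuclideanSpace ℝ (Fin 3) | p ∈ hcpStacking a h ∧ p ≠ 0 ∧ ‖p‖ < 13 / 10 * a},
          ∀ t : ↥{z : EuclideanSpace ℝ (Fin 3) | z ∈ S ∧ z ≠ y ∧ dist z (y) < 13 / 10 * a},
            dist ((t : EuclideanSpace ℝ (Fin 3)) - y)
              (A ((e t : ↥{p : EuclideanSpace ℝ (Fin 3) | p ∈ hcpStacking a h ∧ p ≠ 0 ∧ ‖p‖ < 13 / 10 * a}) : EuclideanSpace ℝ (Fin 3))) ≤ τ) ∨
        (∃ e : ↥{z : EuclideanSpace ℝ (Fin 3) | z ∈ S ∧ z ≠ y ∧ dist z (y) < 13 / 10 * a} ≃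
            ↥{p : EuclideanSpace ℝ (Fin 3) | p ∈ fccStacking a h ∧ p ≠ 0 ∧ ‖p‖ < 13 / 10 * a},
          ∀ t : ↥{z : EuclideanSpace ℝ (Fin 3) | z ∈ S ∧ z ≠ y ∧ dist z (y) < 13 / 10 * a},
            dist ((t : EuclideanSpace ℝ (Fin 3)) - y)
              (A ((e t : ↥{p : EuclideanSpace ℝ (Fin 3) | p ∈ fccStacking a h ∧ p ≠ 0 ∧ ‖p‖ < 13 / 10 * a}) : EuclideanSpace ℝ (Fin 3))) ≤ τ)) := by
  sorry

/-- **Stub B-fcc — MATCHED NEIGHBOURHOOD ⇒ τ-GOOD SHELL, fcc reference (M; geometry, worker).**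
The same with the reference stacking `fccStacking a h` (K1's fcc disjunct, same `A`); the norm gap of
`fccStacking a h` on the box is again `(1.009a, 1.408a)`. [folklore] -/
theorem stub_goodShell_of_matching_fcc :
    ∀ (a h : ℝ), 47 / 50 ≤ a → a ≤ 1 → |h - a * Real.sqrt (2 / 3)| ≤ a / 100 →
    ∀ (θ τ : ℝ), 0 ≤ θ → θ ≤ τ → θ ≤ a / 20 →
    ∀ (S : Set (EuclideanSpace ℝ (Fin 3))), (∀ u ∈ S, ∀ v ∈ S, u ≠ v → (1 / 3 : ℝ) ≤ dist u v) →
    ∀ y ∈ S, ∀ (A : EuclideanSpace ℝ (Fin 3) →ₗᵢ[ℝ] EuclideanSpace ℝ (Fin 3)),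
      (∀ p ∈ fccStacking a h, p ≠ 0 → ‖p‖ ≤ 3 / 2 * a → ∃ z ∈ S, dist z (y + A p) ≤ θ) →
      (∀ z ∈ S, z ≠ y → dist z y ≤ 3 / 2 * a → ∃ p ∈ fccStacking a h, dist z (y + A p) ≤ θ) →
      (∃ A : EuclideanSpace ℝ (Fin 3) →ₗᵢ[ℝ] EuclideanSpace ℝ (Fin 3),
        (∃ e : ↥{z : EuclideanSpace ℝ (Fin 3) | z ∈ S ∧ z ≠ y ∧ dist z (y) < 13 / 10 * a} ≃
            ↥{p : EuclideanSpace ℝ (Fin 3) | p ∈ hcpStacking a h ∧ p ≠ 0 ∧ ‖p‖ < 13 / 10 * a},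
          ∀ t : ↥{z : EuclideanSpace ℝ (Fin 3) | z ∈ S ∧ z ≠ y ∧ dist z (y) < 13 / 10 * a},
            dist ((t : EuclideanSpace ℝ (Fin 3)) - y)
              (A ((e t : ↥{p : EuclideanSpace ℝ (Fin 3) | p ∈ hcpStacking a h ∧ p ≠ 0 ∧ ‖p‖ < 13 / 10 * a}) : EuclideanSpace ℝ (Fin 3))) ≤ τ) ∨
        (∃ e : ↥{z : EuclideanSpace ℝ (Fin 3) | z ∈ S ∧ z ≠ y ∧ dist z (y) < 13 / 10 * a} ≃
            ↥{p : EuclideanSpace ℝ (Fin 3) | p ∈ fccStacking a h ∧ p ≠ 0 ∧ ‖p‖ < 13 / 10 * a},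
          ∀ t : ↥{z : EuclideanSpace ℝ (Fin 3) | z ∈ S ∧ z ≠ y ∧ dist z (y) < 13 / 10 * a},
            dist ((t : EuclideanSpace ℝ (Fin 3)) - y)
              (A ((e t : ↥{p : EuclideanSpace ℝ (Fin 3) | p ∈ fccStacking a h ∧ p ≠ 0 ∧ ‖p‖ < 13 / 10 * a}) : EuclideanSpace ℝ (Fin 3))) ≤ τ)) := by
  sorry

/-- **Stub 1a′ — CALIBRATED SITE INEQUALITY, PERIODIC HOSTS, QUADRATIC PRICE (XL; the analytic core; lead).**
For every box minimiser `(a, h)` of `e(hcp ·,·)`, GIVEN the two matching ⇒ τ-good bridges at `(a, h)`,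
there are a depth `R > 0`, a flux bound `G ≥ 0` and a price constant `c > 0` such that for every
tolerance `0 < τ ≤ 1/20` and every periodic `P` with `1/3`-separated points there is a pair flux `g`,
antisymmetric, `r⁻⁶`-dominated, covariant under the period lattice, which CALIBRATES the site energies:
at every point `y ∈ P.points` whose `R`-neighbourhood is `1/20`-two-shell-good,
`e(hcp a h) ≤ ½ Σ'_{z ≠ y} V_LJ(dist y z) + Σ'_{z ≠ y} g y z`, and `e(hcp a h) + c·τ² ≤ (same)` when the first
shell of `y` is τ-bad at `(a, h)`.
Why plausibly true (order by order, at a deep-good site in its local Barlow chart): zeroth order = the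
landed layered pricing of exact relaxed Barlow multilattices (`HcpLandscapeGapBirth.stub_relaxedBarlowPricing`
p167995, every Hägg word / spacing profile / in-layer scale priced above `e(hcp a h)`), in pointwise form
with a short vertical flux (12087-calibration stub Z); first order = the pair-force flux
`g¹(y,z) = −½V′(r_yz) ê_yz·(u_y + u_z)` which kills the linear term of EVERY site energy of a force-balanced
reference (Σ_z V′ê_yz = 0), `|g¹| ≲ |u| r⁻⁷`; second order = a covariant quadratic flux from the
word-uniform harmonic certificate (idea `riccati-sign-chain`: common Riccati supersolution found at
102/102 in-plane wave vectors, kit j027064; first lemma `riccatiChainBound` proved) plus the `r⁻⁸`-summable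
tail (≤ 0.101 of the truncated form); τ-badness at the exact cell forces chart displacement `≥ τ/L`
(the bridges, contrapositive), whence `c·τ²`; the 1 %–5 % annulus of two-shell-goodness needs a certified
non-perturbative shell-space bound (RADIUS risk).  Numerics (kit csi_lp.py, this cycle): LP value of the
minimal flux constant `G*` making the calibration pointwise on adversarial two-shell-good periodic hosts.
Why it might fail: a pointwise (rather than regional) calibration may need `G → ∞` on some host family
(then reshape to the LP-dual regional form `Σ_{y∈A}(E_y − e_h − κ1_bad) ≥ −G·cap₆(A, P.points∖A)`), or the
quadratic law may fail non-perturbatively in the annulus. [folklore] -/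
theorem stub_calibratedSiteInequalityQuadratic :
    ∀ (a h : ℝ) (ha : a ≠ 0) (hh : h ≠ 0), (9 / 10 < a ∧ a < 1 ∧ |h - a * Real.sqrt (2 / 3)| ≤ a / 100) →
      (∀ a' h' : ℝ, ∀ ha' : a' ≠ 0, ∀ hh' : h' ≠ 0, (9 / 10 < a' ∧ a' < 1 ∧ |h' - a' * Real.sqrt (2 / 3)| ≤ a' / 100) →
        (hcpPeriodicConfiguration ha hh).energyPerParticle lennardJones ≤
          (hcpPeriodicConfiguration ha' hh').energyPerParticle lennardJones) →
      (∀ (θ τ : ℝ), 0 ≤ θ → θ ≤ τ → θ ≤ a / 20 →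
        ∀ (S : Set (EuclideanSpace ℝ (Fin 3))), (∀ u ∈ S, ∀ v ∈ S, u ≠ v → (1 / 3 : ℝ) ≤ dist u v) →
        ∀ y ∈ S, ∀ (A : EuclideanSpace ℝ (Fin 3) →ₗᵢ[ℝ] EuclideanSpace ℝ (Fin 3)),
          (∀ p ∈ hcpStacking a h, p ≠ 0 → ‖p‖ ≤ 3 / 2 * a → ∃ z ∈ S, dist z (y + A p) ≤ θ) →
          (∀ z ∈ S, z ≠ y → dist z y ≤ 3 / 2 * a → ∃ p ∈ hcpStacking a h, dist z (y + A p) ≤ θ) →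
          GoodShell a h τ S y) →
      (∀ (θ τ : ℝ), 0 ≤ θ → θ ≤ τ → θ ≤ a / 20 →
        ∀ (S : Set (EuclideanSpace ℝ (Fin 3))), (∀ u ∈ S, ∀ v ∈ S, u ≠ v → (1 / 3 : ℝ) ≤ dist u v) →
        ∀ y ∈ S, ∀ (A : EuclideanSpace ℝ (Fin 3) →ₗᵢ[ℝ] EuclideanSpace ℝ (Fin 3)),
          (∀ p ∈ fccStacking a h, p ≠ 0 → ‖p‖ ≤ 3 / 2 * a → ∃ z ∈ S, dist z (y + A p) ≤ θ) →
          (∀ z ∈ S, z ≠ y → dist z y ≤ 3 / 2 * a → ∃ p ∈ fccStacking a h, dist z (y + A p) ≤ θ) →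
          GoodShell a h τ S y) →
      ∃ R : ℝ, 0 < R ∧ ∃ G : ℝ, 0 ≤ G ∧ ∃ c : ℝ, 0 < c ∧ ∀ τ : ℝ, 0 < τ → τ ≤ 1 / 20 →
        ∀ P : PeriodicConfiguration 3, (∀ u ∈ P.points, ∀ v ∈ P.points, u ≠ v → (1 / 3 : ℝ) ≤ dist u v) →
          ∃ g : EuclideanSpace ℝ (Fin 3) → EuclideanSpace ℝ (Fin 3) → ℝ,
            (∀ y z, g y z = -g z y) ∧
            (∀ y z, |g y z| ≤ G * (dist y z)⁻¹ ^ 6) ∧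
            (∀ v ∈ P.lattice, ∀ y z, g (y + v) (z + v) = g y z) ∧
            (∀ y ∈ P.points, (∀ p ∈ P.points, dist p y ≤ R → IsTwoShellGoodSet (1 / 20) (47 / 50) 1 P.points p) →
                (hcpPeriodicConfiguration ha hh).energyPerParticle lennardJones
                  ≤ 1 / 2 * (∑' z : {z // z ∈ P.points ∧ z ≠ y}, lennardJones (dist y z.1))
                      + ∑' z : {z // z ∈ P.points ∧ z ≠ y}, g y z.1) ∧
            (∀ y ∈ P.points, (∀ p ∈ P.points, dist p y ≤ R → IsTwoShellGoodSet (1 / 20) (47 / 50) 1 P.points p) →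
                ¬ GoodShell a h τ P.points y →
                (hcpPeriodicConfiguration ha hh).energyPerParticle lennardJones + c * τ ^ 2
                  ≤ 1 / 2 * (∑' z : {z // z ∈ P.points ∧ z ≠ y}, lennardJones (dist y z.1))
                      + ∑' z : {z // z ∈ P.points ∧ z ≠ y}, g y z.1) := by
  sorry

/-- **CSI, periodic form, `∀ τ ∈ (0,1] ∃ κ` (the v3 residual restricted to periodic hosts): a THEOREM of
Stub 1a′ and the two bridges.**  For `τ ≤ 1/20` take `κ = c·τ²`; for `τ > 1/20` a τ-bad shell is
`1/20`-bad (`goodShell_mono`), so `κ = c/400` works; the bridges are fed at `(a, h)`, which lies in K1's box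
by the landed enclosure `stub_boxMinimiserRigid` (`a ≥ 0.97119 ≥ 47/50`). [folklore] -/
theorem calibratedSiteInequalityPeriodic :
    ∀ (a h : ℝ) (ha : a ≠ 0) (hh : h ≠ 0), (9 / 10 < a ∧ a < 1 ∧ |h - a * Real.sqrt (2 / 3)| ≤ a / 100) →
      (∀ a' h' : ℝ, ∀ ha' : a' ≠ 0, ∀ hh' : h' ≠ 0, (9 / 10 < a' ∧ a' < 1 ∧ |h' - a' * Real.sqrt (2 / 3)| ≤ a' / 100) →
        (hcpPeriodicConfiguration ha hh).energyPerParticle lennardJones ≤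
          (hcpPeriodicConfiguration ha' hh').energyPerParticle lennardJones) →
      ∃ R : ℝ, 0 < R ∧ ∃ G : ℝ, 0 ≤ G ∧ ∀ τ : ℝ, 0 < τ → τ ≤ 1 → ∃ κ : ℝ, 0 < κ ∧
        ∀ P : PeriodicConfiguration 3, (∀ u ∈ P.points, ∀ v ∈ P.points, u ≠ v → (1 / 3 : ℝ) ≤ dist u v) →
          ∃ g : EuclideanSpace ℝ (Fin 3) → EuclideanSpace ℝ (Fin 3) → ℝ,
            (∀ y z, g y z = -g z y) ∧
            (∀ y z, |g y z| ≤ G * (dist y z)⁻¹ ^ 6) ∧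
            (∀ v ∈ P.lattice, ∀ y z, g (y + v) (z + v) = g y z) ∧
            (∀ y ∈ P.points, (∀ p ∈ P.points, dist p y ≤ R → IsTwoShellGoodSet (1 / 20) (47 / 50) 1 P.points p) →
                (hcpPeriodicConfiguration ha hh).energyPerParticle lennardJones
                  ≤ 1 / 2 * (∑' z : {z // z ∈ P.points ∧ z ≠ y}, lennardJones (dist y z.1))
                      + ∑' z : {z // z ∈ P.points ∧ z ≠ y}, g y z.1) ∧
            (∀ y ∈ P.points, (∀ p ∈ P.points, dist p y ≤ R → IsTwoShellGoodSet (1 / 20) (47 / 50) 1 P.points p) →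
                ¬ GoodShell a h τ P.points y →
                (hcpPeriodicConfiguration ha hh).energyPerParticle lennardJones + κ
                  ≤ 1 / 2 * (∑' z : {z // z ∈ P.points ∧ z ≠ y}, lennardJones (dist y z.1))
                      + ∑' z : {z // z ∈ P.points ∧ z ≠ y}, g y z.1) := by
  intro a h ha hh hbox hmin
  -- the cell lies in K1's box (landed enclosure), so the bridges apply at `(a, h)`
  obtain ⟨⟨hea, -⟩, -⟩ := HcpLandscapeGapBirth.stub_boxMinimiserRigid a h ha hh hbox hmin
  have ha47 : 47 / 50 ≤ a := by
    have := (abs_le.1 hea).1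
    linarith
  obtain ⟨R, hR, G, hG, c, hc, H⟩ := stub_calibratedSiteInequalityQuadratic a h ha hh hbox hmin
    (stub_goodShell_of_matching_hcp a h ha47 hbox.2.1.le hbox.2.2)
    (stub_goodShell_of_matching_fcc a h ha47 hbox.2.1.le hbox.2.2)
  refine ⟨R, hR, G, hG, ?_⟩
  intro τ hτ0 hτ1
  -- work at the clipped tolerance τ' = min τ (1/20)
  set τ' : ℝ := min τ (1 / 20) with hτ'
  have hτ'0 : 0 < τ' := lt_min hτ0 (by norm_num)
  have hτ'1 : τ' ≤ 1 / 20 := min_le_right _ _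
  have hτ'τ : τ' ≤ τ := min_le_left _ _
  refine ⟨c * τ' ^ 2, by positivity, ?_⟩
  intro P hsep
  obtain ⟨g, hanti, hdec, hcov, hgood, hbad⟩ := H τ' hτ'0 hτ'1 P hsep
  refine ⟨g, hanti, hdec, hcov, hgood, ?_⟩
  intro y hy hdeep hnot
  exact hbad y hy hdeep (fun hg => hnot (goodShell_mono hτ'τ hg))

/-! **Stub 1b — TORUS DIVERGENCE LEMMA: LANDED** (worker W2 of lead c1, p172565,
`Theorems/SpectralChargeLedgerSummedShellPricingTorusDivergence.lean`,
`SummedShellPricingTorusDivergence.stub_torusDivergence`): the divergence of an antisymmetric, lattice-covariant,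
`r⁻⁶`-dominated pair flux sums to zero over the motif of a periodic configuration of `ℝ³`,
`Σ_{y ∈ motif} Σ'_{z ∈ points, z ≠ y} g y z = 0` (sign-reversing involution `(y, m, λ) ↦ (m, y, −λ)` on the
absolutely summable triple family).  Used below by its tree name; reusable helpers there:
`tsum_motif_lattice_eq`, `motif_add_lattice_injective`, `summable_inv_pow_six_motif_lattice`. -/

/-! **Stub 1c — CALIBRATED FLOOR: LANDED** (worker W3 of lead c1, p172604,
`Theorems/SpectralChargeLedgerSummedShellPricingCalibratedFloor.lean`,
`SummedShellPricingCalibratedFloor.stub_calibratedFloor`, `C₀ = (1/12 + G)·250·3⁶`): on every `1/3`-separated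
`S ⊆ ℝ³`, for every pair flux with `|g y z| ≤ G·(dist y z)⁻⁶`, every calibrated site energy
`½ Σ'_{z ≠ y} V_LJ + Σ'_{z ≠ y} g y z` is at least `−C₀`.  Used below by its tree name; reusable helper there:
`tsum_inv_pow_six_le_of_separated`. -/

/-- **Composition of the calibration cut, periodic form**: calibrated site inequality on periodic hosts ∧
torus divergence ∧ calibrated floor ⇒ the interior relative ledger at every box minimiser (the v2 stub
`stub_interiorLedgerAt`), with `c = κ(τ)` and allowance `C = C₀ + |e(hcp a h)|`: summing the calibrated site
energies over the motif gives `#motif·e(P)` exactly (the divergence vanishes on the torus); deep-good sites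
contribute `≥ e(hcp a h)` (`+ κ` if τ-bad), all other motif sites — those within `R` of a two-shell-bad point —
contribute `≥ −C₀`.  (The `∀ S` form of this composition is landed: `SummedShellPricingCalibration.
interiorLedgerAt_of_calibration`, p172992; this is the same proof with the host quantifier restricted.)
[folklore] -/
theorem interiorLedgerAt_of_calibrationPeriodic
    (hcal : ∀ (a h : ℝ) (ha : a ≠ 0) (hh : h ≠ 0), (9 / 10 < a ∧ a < 1 ∧ |h - a * Real.sqrt (2 / 3)| ≤ a / 100) →
      (∀ a' h' : ℝ, ∀ ha' : a' ≠ 0, ∀ hh' : h' ≠ 0, (9 / 10 < a' ∧ a' < 1 ∧ |h' - a' * Real.sqrt (2 / 3)| ≤ a' / 100) →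
        (hcpPeriodicConfiguration ha hh).energyPerParticle lennardJones ≤
          (hcpPeriodicConfiguration ha' hh').energyPerParticle lennardJones) →
      ∃ R : ℝ, 0 < R ∧ ∃ G : ℝ, 0 ≤ G ∧ ∀ τ : ℝ, 0 < τ → τ ≤ 1 → ∃ κ : ℝ, 0 < κ ∧
        ∀ P : PeriodicConfiguration 3, (∀ u ∈ P.points, ∀ v ∈ P.points, u ≠ v → (1 / 3 : ℝ) ≤ dist u v) →
          ∃ g : EuclideanSpace ℝ (Fin 3) → EuclideanSpace ℝ (Fin 3) → ℝ,
            (∀ y z, g y z = -g z y) ∧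
            (∀ y z, |g y z| ≤ G * (dist y z)⁻¹ ^ 6) ∧
            (∀ v ∈ P.lattice, ∀ y z, g (y + v) (z + v) = g y z) ∧
            (∀ y ∈ P.points, (∀ p ∈ P.points, dist p y ≤ R → IsTwoShellGoodSet (1 / 20) (47 / 50) 1 P.points p) →
                (hcpPeriodicConfiguration ha hh).energyPerParticle lennardJones
                  ≤ 1 / 2 * (∑' z : {z // z ∈ P.points ∧ z ≠ y}, lennardJones (dist y z.1))
                      + ∑' z : {z // z ∈ P.points ∧ z ≠ y}, g y z.1) ∧
            (∀ y ∈ P.points, (∀ p ∈ P.points, dist p y ≤ R → IsTwoShellGoodSet (1 / 20) (47 / 50) 1 P.points p) →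
                ¬ GoodShell a h τ P.points y →
                (hcpPeriodicConfiguration ha hh).energyPerParticle lennardJones + κ
                  ≤ 1 / 2 * (∑' z : {z // z ∈ P.points ∧ z ≠ y}, lennardJones (dist y z.1))
                      + ∑' z : {z // z ∈ P.points ∧ z ≠ y}, g y z.1))
    (hdiv : ∀ (P : PeriodicConfiguration 3) (g : EuclideanSpace ℝ (Fin 3) → EuclideanSpace ℝ (Fin 3) → ℝ) (G : ℝ),
      (∀ y z, g y z = -g z y) →
      (∀ v ∈ P.lattice, ∀ y z, g (y + v) (z + v) = g y z) →
      (∀ y z, |g y z| ≤ G * (dist y z)⁻¹ ^ 6) →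
      ∑ y ∈ P.motif, ∑' z : {z // z ∈ P.points ∧ z ≠ y}, g y z.1 = 0)
    (hfloor : ∀ G : ℝ, 0 ≤ G → ∃ C₀ : ℝ, 0 ≤ C₀ ∧
      ∀ S : Set (EuclideanSpace ℝ (Fin 3)), (∀ u ∈ S, ∀ v ∈ S, u ≠ v → (1 / 3 : ℝ) ≤ dist u v) →
        ∀ g : EuclideanSpace ℝ (Fin 3) → EuclideanSpace ℝ (Fin 3) → ℝ,
          (∀ y z, |g y z| ≤ G * (dist y z)⁻¹ ^ 6) →
          ∀ y ∈ S, -C₀ ≤ 1 / 2 * (∑' z : {z // z ∈ S ∧ z ≠ y}, lennardJones (dist y z.1))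
                        + ∑' z : {z // z ∈ S ∧ z ≠ y}, g y z.1) :
    ∀ (a h : ℝ) (ha : a ≠ 0) (hh : h ≠ 0), (9 / 10 < a ∧ a < 1 ∧ |h - a * Real.sqrt (2 / 3)| ≤ a / 100) →
      (∀ a' h' : ℝ, ∀ ha' : a' ≠ 0, ∀ hh' : h' ≠ 0, (9 / 10 < a' ∧ a' < 1 ∧ |h' - a' * Real.sqrt (2 / 3)| ≤ a' / 100) →
        (hcpPeriodicConfiguration ha hh).energyPerParticle lennardJones ≤
          (hcpPeriodicConfiguration ha' hh').energyPerParticle lennardJones) →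
      ∃ R : ℝ, 0 < R ∧ ∃ C : ℝ, 0 ≤ C ∧ ∀ τ : ℝ, 0 < τ → τ ≤ 1 → ∃ c : ℝ, 0 < c ∧
        ∀ P : PeriodicConfiguration 3, (∀ u ∈ P.points, ∀ v ∈ P.points, u ≠ v → (1 / 3 : ℝ) ≤ dist u v) →
          c * ((P.motif.filter fun q => ¬ GoodShell a h τ P.points q ∧
                ∀ p ∈ P.points, dist p q ≤ R → IsTwoShellGoodSet (1 / 20) (47 / 50) 1 P.points p).card : ℝ)
            - C * ((P.motif.filter fun q =>
                ∃ p ∈ P.points, dist p q ≤ R ∧ ¬ IsTwoShellGoodSet (1 / 20) (47 / 50) 1 P.points p).card : ℝ)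
          ≤ (P.motif.card : ℝ) *
              (P.energyPerParticle lennardJones - (hcpPeriodicConfiguration ha hh).energyPerParticle lennardJones) := by
  intro a h ha hh hbox hmin
  obtain ⟨R, hR, G, hG, hτ⟩ := hcal a h ha hh hbox hmin
  obtain ⟨C₀, hC₀, hfl⟩ := hfloor G hG
  refine ⟨R, hR, C₀ + |(hcpPeriodicConfiguration ha hh).energyPerParticle lennardJones|, by positivity, ?_⟩
  intro τ hτ0 hτ1
  obtain ⟨κ, hκ, hS⟩ := hτ τ hτ0 hτ1
  refine ⟨κ, hκ, ?_⟩
  intro P hsep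
  obtain ⟨g, hanti, hdec, hcovL, hgood, hbad⟩ := hS P hsep
  set eh : ℝ := (hcpPeriodicConfiguration ha hh).energyPerParticle lennardJones with heh
  -- the calibrated site functional
  set F : EuclideanSpace ℝ (Fin 3) → ℝ := fun y =>
    1 / 2 * (∑' z : {z // z ∈ P.points ∧ z ≠ y}, lennardJones (dist y z.1))
      + ∑' z : {z // z ∈ P.points ∧ z ≠ y}, g y z.1 with hF
  -- (i) the divergence vanishes on the torus, so `Σ_motif F = #motif · e(P)`
  have hdiv0 : ∑ y ∈ P.motif, ∑' z : {z // z ∈ P.points ∧ z ≠ y}, g y z.1 = 0 :=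
    hdiv P g G hanti hcovL hdec
  have hcard0 : (P.motif.card : ℝ) ≠ 0 := by
    exact_mod_cast (P.motif_nonempty.card_pos).ne'
  have hsumF : ∑ y ∈ P.motif, F y = (P.motif.card : ℝ) * P.energyPerParticle lennardJones := by
    simp only [hF, Finset.sum_add_distrib, hdiv0, add_zero]
    unfold PeriodicConfiguration.energyPerParticle
    rw [← Finset.mul_sum]
    field_simp
  -- (ii) names for the three finsets of the statement and the deep set
  set IB := (P.motif.filter fun q => ¬ GoodShell a h τ P.points q ∧
      ∀ p ∈ P.points, dist p q ≤ R → IsTwoShellGoodSet (1 / 20) (47 / 50) 1 P.points p) with hIBdef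
  set Sp := (P.motif.filter fun q =>
      ∃ p ∈ P.points, dist p q ≤ R ∧ ¬ IsTwoShellGoodSet (1 / 20) (47 / 50) 1 P.points p) with hSpdef
  set Dp := (P.motif.filter fun q =>
      ∀ p ∈ P.points, dist p q ≤ R → IsTwoShellGoodSet (1 / 20) (47 / 50) 1 P.points p) with hDpdef
  -- (iii) pointwise bounds
  have hlow_deep : ∀ y ∈ Dp, eh + (if ¬ GoodShell a h τ P.points y then κ else 0) ≤ F y := by
    intro y hy
    rw [hDpdef, Finset.mem_filter] at hy
    have hyS : y ∈ P.points := P.mem_points_of_mem_motif hy.1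
    by_cases hb : ¬ GoodShell a h τ P.points y
    · rw [if_pos hb]
      exact hbad y hyS hy.2 hb
    · rw [if_neg hb, add_zero]
      exact hgood y hyS hy.2
  have hlow_rest : ∀ y ∈ Sp, -C₀ ≤ F y := by
    intro y hy
    rw [hSpdef, Finset.mem_filter] at hy
    exact hfl P.points hsep g hdec y (P.mem_points_of_mem_motif hy.1)
  -- (iv) bookkeeping
  have hSp_eq : P.motif.filter (fun q => ¬ ∀ p ∈ P.points, dist p q ≤ R →
      IsTwoShellGoodSet (1 / 20) (47 / 50) 1 P.points p) = Sp := by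
    rw [hSpdef]
    refine Finset.filter_congr fun q _ => ?_
    simp only [not_forall, exists_prop]
  have hsplit : ∑ y ∈ P.motif, F y = ∑ y ∈ Dp, F y + ∑ y ∈ Sp, F y := by
    rw [← hSp_eq, hDpdef]
    exact (Finset.sum_filter_add_sum_filter_not P.motif _ F).symm
  have hcardsum : (Dp.card : ℝ) + (Sp.card : ℝ) = (P.motif.card : ℝ) := by
    rw [← hSp_eq, hDpdef]
    exact_mod_cast Finset.card_filter_add_card_filter_not _
  have hIB_eq : Dp.filter (fun q => ¬ GoodShell a h τ P.points q) = IB := by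
    rw [hDpdef, hIBdef, Finset.filter_filter]
    refine Finset.filter_congr fun q _ => ?_
    tauto
  have h1 : (Dp.card : ℝ) * eh + κ * (IB.card : ℝ) ≤ ∑ y ∈ Dp, F y := by
    have h := Finset.sum_le_sum hlow_deep
    rw [Finset.sum_add_distrib, Finset.sum_const, nsmul_eq_mul, Finset.sum_ite, Finset.sum_const_zero,
      add_zero, Finset.sum_const, nsmul_eq_mul, hIB_eq] at h
    linarith
  have h2 : -C₀ * (Sp.card : ℝ) ≤ ∑ y ∈ Sp, F y := by
    have h := Finset.sum_le_sum hlow_rest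
    rw [Finset.sum_const, nsmul_eq_mul] at h
    linarith
  have hSp0 : (0 : ℝ) ≤ (Sp.card : ℝ) := Nat.cast_nonneg _
  have hprod : eh * (Sp.card : ℝ) ≤ |eh| * (Sp.card : ℝ) :=
    mul_le_mul_of_nonneg_right (le_abs_self eh) hSp0
  have hNeh : (P.motif.card : ℝ) * eh = (Dp.card : ℝ) * eh + (Sp.card : ℝ) * eh := by
    rw [← hcardsum]; ring
  have hgoal : κ * (IB.card : ℝ) - (C₀ + |eh|) * (Sp.card : ℝ)
      ≤ (P.motif.card : ℝ) * P.energyPerParticle lennardJones - (P.motif.card : ℝ) * eh := by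
    linarith [hsumF, hsplit, h1, h2, hprod, hNeh]
  linarith [hgoal]

/-- The v2 residual `stub_interiorLedgerAt` (interior relative ledger at every box minimiser), now a
THEOREM of Stub 1a′, the two bridges and the two landed v3 stubs. [folklore] -/
theorem interiorLedgerAt :
    ∀ (a h : ℝ) (ha : a ≠ 0) (hh : h ≠ 0), (9 / 10 < a ∧ a < 1 ∧ |h - a * Real.sqrt (2 / 3)| ≤ a / 100) →
      (∀ a' h' : ℝ, ∀ ha' : a' ≠ 0, ∀ hh' : h' ≠ 0, (9 / 10 < a' ∧ a' < 1 ∧ |h' - a' * Real.sqrt (2 / 3)| ≤ a' / 100) →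
        (hcpPeriodicConfiguration ha hh).energyPerParticle lennardJones ≤
          (hcpPeriodicConfiguration ha' hh').energyPerParticle lennardJones) →
      ∃ R : ℝ, 0 < R ∧ ∃ C : ℝ, 0 ≤ C ∧ ∀ τ : ℝ, 0 < τ → τ ≤ 1 → ∃ c : ℝ, 0 < c ∧
        ∀ P : PeriodicConfiguration 3, (∀ u ∈ P.points, ∀ v ∈ P.points, u ≠ v → (1 / 3 : ℝ) ≤ dist u v) →
          c * ((P.motif.filter fun q => ¬ GoodShell a h τ P.points q ∧
                ∀ p ∈ P.points, dist p q ≤ R → IsTwoShellGoodSet (1 / 20) (47 / 50) 1 P.points p).card : ℝ)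
            - C * ((P.motif.filter fun q =>
                ∃ p ∈ P.points, dist p q ≤ R ∧ ¬ IsTwoShellGoodSet (1 / 20) (47 / 50) 1 P.points p).card : ℝ)
          ≤ (P.motif.card : ℝ) *
              (P.energyPerParticle lennardJones - (hcpPeriodicConfiguration ha hh).energyPerParticle lennardJones) :=
  interiorLedgerAt_of_calibrationPeriodic calibratedSiteInequalityPeriodic
    SummedShellPricingTorusDivergence.stub_torusDivergence
    SummedShellPricingCalibratedFloor.stub_calibratedFloor


/-- The ∃-cell interior ledger (the strategists' `stub_interiorLedger`, s1) from Stub 1 at the LANDED box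
minimiser: `stub_boxMinimiser` gives the cell, `stub_boxMinimiserRigid` encloses it at `0.97129 ± 10⁻⁴`, hence
`47/50 ≤ a ≤ 1`. [folklore] -/
theorem interiorLedger_exists :
    ∃ (a₀ h₀ : ℝ) (ha : a₀ ≠ 0) (hh : h₀ ≠ 0), 47 / 50 ≤ a₀ ∧ a₀ ≤ 1 ∧ |h₀ - a₀ * Real.sqrt (2 / 3)| ≤ a₀ / 100 ∧
      ∃ R : ℝ, 0 < R ∧ ∃ C : ℝ, 0 ≤ C ∧ ∀ τ : ℝ, 0 < τ → τ ≤ 1 → ∃ c : ℝ, 0 < c ∧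
        ∀ P : PeriodicConfiguration 3, (∀ u ∈ P.points, ∀ v ∈ P.points, u ≠ v → (1 / 3 : ℝ) ≤ dist u v) →
          c * ((P.motif.filter fun q => ¬ GoodShell a₀ h₀ τ P.points q ∧
                ∀ p ∈ P.points, dist p q ≤ R → IsTwoShellGoodSet (1 / 20) (47 / 50) 1 P.points p).card : ℝ)
            - C * ((P.motif.filter fun q =>
                ∃ p ∈ P.points, dist p q ≤ R ∧ ¬ IsTwoShellGoodSet (1 / 20) (47 / 50) 1 P.points p).card : ℝ)
          ≤ (P.motif.card : ℝ) *
              (P.energyPerParticle lennardJones - (hcpPeriodicConfiguration ha hh).energyPerParticle lennardJones) := by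
  obtain ⟨a, h, ha, hh, hbox, hmin⟩ := HcpLandscapeGapBirth.stub_boxMinimiser
  obtain ⟨⟨hea, -⟩, -⟩ := HcpLandscapeGapBirth.stub_boxMinimiserRigid a h ha hh hbox hmin
  obtain ⟨R, hR, C, hC, H⟩ := interiorLedgerAt a h ha hh hbox hmin
  refine ⟨a, h, ha, hh, ?_, hbox.2.1.le, hbox.2.2, R, hR, C, hC, H⟩
  have := (abs_le.1 hea).1
  linarith

/-! **Stub 2 — SPOILED-BY-GROSS PACKING LEMMA: LANDED** (worker W1 of lead c1, p172384,
`Theorems/SpectralChargeLedgerSummedShellPricingSpoiledByGross.lean`, `SummedShellPricingSpoiledByGross.stub_spoiledByGross`,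
`K = (6R+1)³`): for every depth `R > 0` there is `K ≥ 0` such that in every periodic `P` with `1/3`-separated
points the number of motif sites within `R` of SOME two-shell-bad point of `P.points` is at most `K` times the
number of two-shell-bad MOTIF sites.  Used below by its tree name. -/

/-! ## Composition (sorry-free) -/

/-- Interior ledger ∧ packing ⇒ the relative ledger: a mild site is either `R`-interior (priced by stub 1)
or within `R` of a gross point (counted by stub 2); take `c' = min c 1` and the τ-independent allowance
`C' = (C + 1)·K`. [folklore] -/
theorem hcpRelativeLedger_of
    (h₁ : ∃ (a₀ h₀ : ℝ) (ha : a₀ ≠ 0) (hh : h₀ ≠ 0), 47 / 50 ≤ a₀ ∧ a₀ ≤ 1 ∧ |h₀ - a₀ * Real.sqrt (2 / 3)| ≤ a₀ / 100 ∧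
      ∃ R : ℝ, 0 < R ∧ ∃ C : ℝ, 0 ≤ C ∧ ∀ τ : ℝ, 0 < τ → τ ≤ 1 → ∃ c : ℝ, 0 < c ∧
        ∀ P : PeriodicConfiguration 3, (∀ u ∈ P.points, ∀ v ∈ P.points, u ≠ v → (1 / 3 : ℝ) ≤ dist u v) →
          c * ((P.motif.filter fun q => ¬ GoodShell a₀ h₀ τ P.points q ∧
                ∀ p ∈ P.points, dist p q ≤ R → IsTwoShellGoodSet (1 / 20) (47 / 50) 1 P.points p).card : ℝ)
            - C * ((P.motif.filter fun q =>
                ∃ p ∈ P.points, dist p q ≤ R ∧ ¬ IsTwoShellGoodSet (1 / 20) (47 / 50) 1 P.points p).card : ℝ)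
          ≤ (P.motif.card : ℝ) *
              (P.energyPerParticle lennardJones - (hcpPeriodicConfiguration ha hh).energyPerParticle lennardJones))
    (h₂ : ∀ R : ℝ, 0 < R → ∃ K : ℝ, 0 ≤ K ∧
      ∀ P : PeriodicConfiguration 3, (∀ u ∈ P.points, ∀ v ∈ P.points, u ≠ v → (1 / 3 : ℝ) ≤ dist u v) →
        ((P.motif.filter fun q =>
            ∃ p ∈ P.points, dist p q ≤ R ∧ ¬ IsTwoShellGoodSet (1 / 20) (47 / 50) 1 P.points p).card : ℝ)
          ≤ K * ((P.motif.filter fun q => ¬ IsTwoShellGoodSet (1 / 20) (47 / 50) 1 P.points q).card : ℝ)) :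
    HcpRelativeLedger := by
  obtain ⟨a₀, h₀, ha, hh, hb1, hb2, hb3, R, hR, C, hC, hτ⟩ := h₁
  obtain ⟨K, hK, hpack⟩ := h₂ R hR
  refine ⟨a₀, h₀, ha, hh, hb1, hb2, hb3, (C + 1) * K, by positivity, ?_⟩
  intro τ hτ0 hτ1
  obtain ⟨c, hc, hP⟩ := hτ τ hτ0 hτ1
  refine ⟨min c 1, lt_min hc one_pos, ?_⟩
  intro P hsep
  have hL := hP P hsep
  have hSK := hpack P hsep
  -- names for the four finsets
  set IB := (P.motif.filter fun q => ¬ GoodShell a₀ h₀ τ P.points q ∧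
      ∀ p ∈ P.points, dist p q ≤ R → IsTwoShellGoodSet (1 / 20) (47 / 50) 1 P.points p) with hIB
  set Sp := (P.motif.filter fun q =>
      ∃ p ∈ P.points, dist p q ≤ R ∧ ¬ IsTwoShellGoodSet (1 / 20) (47 / 50) 1 P.points p) with hSp
  set G := (P.motif.filter fun q => ¬ IsTwoShellGoodSet (1 / 20) (47 / 50) 1 P.points q) with hG
  set M := (P.motif.filter fun q => ¬ GoodShell a₀ h₀ τ P.points q ∧
      IsTwoShellGoodSet (1 / 20) (47 / 50) 1 P.points q) with hM
  -- a mild site is interior-bad or spoiled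
  have hsub : M ⊆ IB ∪ Sp := by
    intro q hq
    rw [hM, Finset.mem_filter] at hq
    rw [Finset.mem_union, hIB, hSp, Finset.mem_filter, Finset.mem_filter]
    by_cases hsp : ∃ p ∈ P.points, dist p q ≤ R ∧ ¬ IsTwoShellGoodSet (1 / 20) (47 / 50) 1 P.points p
    · exact Or.inr ⟨hq.1, hsp⟩
    · refine Or.inl ⟨hq.1, hq.2.1, ?_⟩
      intro p hp hpq
      by_contra hbad
      exact hsp ⟨p, hp, hpq, hbad⟩
  have hcardM : (M.card : ℝ) ≤ (IB.card : ℝ) + (Sp.card : ℝ) := by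
    have := (Finset.card_le_card hsub).trans (Finset.card_union_le IB Sp)
    exact_mod_cast this
  have hIB0 : (0 : ℝ) ≤ IB.card := by positivity
  have hSp0 : (0 : ℝ) ≤ Sp.card := by positivity
  have hG0 : (0 : ℝ) ≤ G.card := by positivity
  have hm0 : (0 : ℝ) ≤ P.motif.card := by positivity
  have hmin1 : min c 1 ≤ 1 := min_le_right _ _
  have hminc : min c 1 ≤ c := min_le_left _ _
  have hmin0 : 0 ≤ min c 1 := le_of_lt (lt_min hc one_pos)
  have hstar : (⨅ Q : PeriodicConfiguration 3, Q.energyPerParticle lennardJones)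
      ≤ (hcpPeriodicConfiguration ha hh).energyPerParticle lennardJones := eStar_le _
  have e1 : min c 1 * (M.card : ℝ) ≤ min c 1 * ((IB.card : ℝ) + (Sp.card : ℝ)) :=
    mul_le_mul_of_nonneg_left hcardM hmin0
  have e2 : min c 1 * (IB.card : ℝ) ≤ c * (IB.card : ℝ) := mul_le_mul_of_nonneg_right hminc hIB0
  have e3 : min c 1 * (Sp.card : ℝ) ≤ 1 * (Sp.card : ℝ) := mul_le_mul_of_nonneg_right hmin1 hSp0
  have e4 : C * (Sp.card : ℝ) ≤ C * (K * (G.card : ℝ)) := mul_le_mul_of_nonneg_left hSK hC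
  nlinarith [e1, e2, e3, e4, hL, hSK, hK, hC, hG0]

/-- The relative ledger implies the core stub of line `Sketch` (`stub_torusCoercivity`, e⋆-form):
`e⋆ ≤ e(hcp(a₀,h₀))` (`eStar_le`) and `#motif ≥ 0`. [folklore] -/
theorem torusCoercivity_of_hcpRelativeLedger (h : HcpRelativeLedger) :
    ∃ a₀ h₀ : ℝ, 47 / 50 ≤ a₀ ∧ a₀ ≤ 1 ∧ |h₀ - a₀ * Real.sqrt (2 / 3)| ≤ a₀ / 100 ∧
      ∃ C : ℝ, 0 ≤ C ∧ ∀ τ : ℝ, 0 < τ → τ ≤ 1 → ∃ c : ℝ, 0 < c ∧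
        ∀ P : PeriodicConfiguration 3, (∀ u ∈ P.points, ∀ v ∈ P.points, u ≠ v → (1 / 3 : ℝ) ≤ dist u v) →
          c * ((P.motif.filter fun q =>
              ¬ (∃ A : EuclideanSpace ℝ (Fin 3) →ₗᵢ[ℝ] EuclideanSpace ℝ (Fin 3),
                  (∃ e : ↥{z : EuclideanSpace ℝ (Fin 3) | z ∈ P.points ∧ z ≠ q ∧ dist z (q) < 13 / 10 * a₀} ≃
                      ↥{p : EuclideanSpace ℝ (Fin 3) | p ∈ hcpStacking a₀ h₀ ∧ p ≠ 0 ∧ ‖p‖ < 13 / 10 * a₀},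
                    ∀ t : ↥{z : EuclideanSpace ℝ (Fin 3) | z ∈ P.points ∧ z ≠ q ∧ dist z (q) < 13 / 10 * a₀},
                      dist ((t : EuclideanSpace ℝ (Fin 3)) - q)
                        (A ((e t : ↥{p : EuclideanSpace ℝ (Fin 3) | p ∈ hcpStacking a₀ h₀ ∧ p ≠ 0 ∧ ‖p‖ < 13 / 10 * a₀}) : EuclideanSpace ℝ (Fin 3))) ≤ τ) ∨
                  (∃ e : ↥{z : EuclideanSpace ℝ (Fin 3) | z ∈ P.points ∧ z ≠ q ∧ dist z (q) < 13 / 10 * a₀} ≃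
                      ↥{p : EuclideanSpace ℝ (Fin 3) | p ∈ fccStacking a₀ h₀ ∧ p ≠ 0 ∧ ‖p‖ < 13 / 10 * a₀},
                    ∀ t : ↥{z : EuclideanSpace ℝ (Fin 3) | z ∈ P.points ∧ z ≠ q ∧ dist z (q) < 13 / 10 * a₀},
                      dist ((t : EuclideanSpace ℝ (Fin 3)) - q)
                        (A ((e t : ↥{p : EuclideanSpace ℝ (Fin 3) | p ∈ fccStacking a₀ h₀ ∧ p ≠ 0 ∧ ‖p‖ < 13 / 10 * a₀}) : EuclideanSpace ℝ (Fin 3))) ≤ τ)) ∧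
              IsTwoShellGoodSet (1 / 20) (47 / 50) 1 P.points q).card : ℝ)
            - C * ((P.motif.filter fun q => ¬ IsTwoShellGoodSet (1 / 20) (47 / 50) 1 P.points q).card : ℝ)
          ≤ (P.motif.card : ℝ) * (P.energyPerParticle lennardJones - (⨅ Q : PeriodicConfiguration 3, Q.energyPerParticle lennardJones)) := by
  obtain ⟨a₀, h₀, ha, hh, hb1, hb2, hb3, C, hC, hτ⟩ := h
  refine ⟨a₀, h₀, hb1, hb2, hb3, C, hC, ?_⟩
  intro τ hτ0 hτ1
  obtain ⟨c, hc, hP⟩ := hτ τ hτ0 hτ1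
  refine ⟨c, hc, ?_⟩
  intro P hsep
  have hL := hP P hsep
  have hstar : (⨅ Q : PeriodicConfiguration 3, Q.energyPerParticle lennardJones)
      ≤ (hcpPeriodicConfiguration ha hh).energyPerParticle lennardJones := eStar_le _
  have hm0 : (0 : ℝ) ≤ P.motif.card := by positivity
  have hmono : (P.motif.card : ℝ) *
      (P.energyPerParticle lennardJones - (hcpPeriodicConfiguration ha hh).energyPerParticle lennardJones)
      ≤ (P.motif.card : ℝ) *
        (P.energyPerParticle lennardJones - (⨅ Q : PeriodicConfiguration 3, Q.energyPerParticle lennardJones)) :=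
    mul_le_mul_of_nonneg_left (by linarith) hm0
  exact hL.trans hmono

/-- **Composition**: the three stubs close the crux BY NAME — interior ledger ∧ packing ⇒ relative
ledger ⇒ core (e⋆-form), and hub crux ∧ core ⇒ K1 by the landed glue of line `Sketch` (p167766). -/
theorem SummedShellPricing_of :
    Summit.AtomisticToContinuum.Crystallization.Theses.SpectralChargeLedger.SummedShellPricing :=
  SummedShellPricingEquivalences.summedShellPricing_of_coerciveTwoShellGap_of_torusCoercivity
    stub_coerciveTwoShellGap
    (torusCoercivity_of_hcpRelativeLedger
      (hcpRelativeLedger_of interiorLedger_exists SummedShellPricingSpoiledByGross.stub_spoiledByGross))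

end Summit.AtomisticToContinuum.Crystallization.Cruxes.SummedShellPricing.Sketch
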